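import Literature.NumberTheory.LFunctions.VerticalArithmeticProgressionsOfZerosProofs
import Literature.NumberTheory.LFunctions.SiegelAbelSummation
import Mathlib.Analysis.Fourier.AddCircle
import Mathlib.MeasureTheory.Integral.IntegralEqImproper
import Mathlib.MeasureTheory.Function.Floor
import Mathlib.Analysis.Normed.Group.Tannery
import Mathlib.NumberTheory.Real.Irrational
import HarnessLib

/-!
# No infinite vertical arithmetic progressions of zeros of a Dirichlet `L`-function — proof

LINE 1 — LABEL: RH-FREE literature (location of zeros of `L(s, χ)` off vertical lattices; no
density statement, no critical line). WHAT THIS IS NOT: nothing here bears on the truth of RH or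
GRH — the theorem constrains no zero's real part.

This file DISCHARGES the named fact
`Literature.NumberTheory.LFunctions.LapidusVanFrankenhuijsen2006_thm11_17_dirichlet`
(`VerticalArithmeticProgressionsOfZeros.lean`): for a Dirichlet character `χ` mod `N`,
`0 < D < 1` and `p > 0` there is an integer `n ≠ 0` with `L(D + inp, χ) ≠ 0` — Lapidus–van
Frankenhuijsen, *Fractal Geometry, Complex Dimensions and Zeta Functions* (2006), Theorem 11.17
(p. 268: Hecke `L`-series "have no infinite sequence of critical zeros forming an arithmetic
progression … In particular, this is true of any Dirichlet `L`-series"). It is the companion of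
`LapidusVanFrankenhuijsen2006_thm11_1_holds` (`VerticalArithmeticProgressionsOfZerosProofs.lean`,
Putnam 1954 for `ζ`), whose statement is used here for the principal character.

## The proof followed (Putnam's Fourier-series argument, transported to `L(s, χ)`; not the book's
## explicit-formula proof)

* `χ = 1` (principal character mod `N`): `L(s, 1_N) = ζ(s) ∏_{p ∣ N} (1 − p^{−s})`
  (Mathlib `DirichletCharacter.LFunctionTrivChar_eq_mul_riemannZeta`); the Euler factors do not
  vanish on `Re s = D > 0` (`‖p^{−s}‖ = p^{−D} < 1`), so the claim is Theorem 11.1 for `ζ`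
  (`LapidusVanFrankenhuijsen2006_thm11_1_holds`).
* `χ ≠ 1`. Suppose `L(s_n, χ) = 0` for all `n ≠ 0`, `s_n = D + inp`, and put `L = 2π/p`,
  `S(m) = Σ_{j ≤ m} χ(j)` (the tree's `DirichletAbel.partialSum`, `|S| ≤ N`). Partial summation
  (Montgomery–Vaughan Thm. 4.8, in the tree as `DirichletAbel.LFunction_eq_abelSum`:
  `L(s, χ) = Σ_{m ≥ 1} S(m)(m^{−s} − (m+1)^{−s})` on `Re s > 0`) is rewritten as the Mellin/Laplace
  form `L(s, χ)/s = ∫_0^∞ S(⌊e^y⌋) e^{−sy} dy` (`integral_step_eq`: on `[log m, log(m+1))` the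
  integrand is `S(m)e^{−sy}`). Hence the function `g(y) = 𝟙_{y>0} S(⌊e^y⌋) e^{−Dy}` has
  `∫_0^∞ e^{−inpy} g(y) dy = L(s_n, χ)/s_n = 0` for `n ≠ 0`, and (unrolling the translates, which
  tile `(−L/2, ∞)`; `integral_cexp_mul_phi`) the translates-sum `Φ(x) = Σ_{k ≥ 0} g(x + kL)` has
  all non-constant Fourier coefficients on the period interval `(−L/2, L/2]` equal to zero; by
  Parseval on an interval (Mathlib `tsum_sq_fourierCoeffOn`) `Φ` is a.e. equal to a constant there
  (`ae_eq_const`).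
* But `Φ` has a non-zero jump at `0`. Along points `x_j ↓ 0`, `y_j ↑ 0`, each term
  `g(x_j + kL) − g(y_j + kL)` tends to the jump `J_k = (S(⌊λ^k⌋) − S(⌈λ^k⌉ − 1)) λ^{−kD}` of `g` at
  `kL` (`λ = e^L`; the floors stabilise: `tendsto_g_right`, `tendsto_g_left`), with a geometric
  majorant, so by Tannery's theorem `Φ(x_j) − Φ(y_j) → J = Σ_k J_k` (`tendsto_phi_sub_phi`).
  Here `J_k = χ(λ^k) λ^{−kD}` if `λ^k` is an integer and `0` otherwise; the integers `k ≥ 1` with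
  `λ^k ∈ ℕ` are exactly the multiples of the least such `k₀` (if any): for `k = ek₀ + r` the number
  `λ^r = λ^k/λ^{ek₀}` is rational with `(λ^r)^{k₀} ∈ ℕ`, hence an integer
  (Mathlib `irrational_nrt_of_notint_nrt`), so `r = 0` by minimality (`dvd_of_isNatPow`). Thus
  `J = Σ_j (χ(m₀) m₀^{−D})^j = (1 − χ(m₀)m₀^{−D})^{−1} ≠ 0` with `m₀ = λ^{k₀} ≥ 2`
  (`tsum_jump_ne_zero`; `J = 1` when no power of `λ` is an integer). Choosing the `x_j, y_j` among
  the a.e.-points where `Φ` equals the constant gives `J = 0`, a contradiction (`not_ae_eq_const`).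
  (Putnam phrases the endgame for `ζ` with one-sided limits of the Fourier series and the sign of
  the sawtooth's jumps; for a complex character the sign argument is replaced by the evaluation of
  the jump as a geometric series.)

Main result: `LapidusVanFrankenhuijsen2006_thm11_17_dirichlet_holds`. Helper lemmas live in the
sub-namespace `PutnamDirichlet`. No definitions, no new named facts (D-0026).

## References

* M. L. Lapidus, M. van Frankenhuijsen, *Fractal Geometry, Complex Dimensions and Zeta
  Functions*, Springer (2006), Theorem 11.17 (p. 268) and Theorem 11.1. [LapidusVanfrankenhuijsen2006]
* C. R. Putnam, *On the non-periodicity of the zeros of the Riemann zeta-function*, Amer. J.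
  Math. 76 (1954) 97–99. [Putnam1954]
* H. L. Montgomery, R. C. Vaughan, *Multiplicative Number Theory I*, CUP 2007, §4.3 Thm. 4.8
  (`L(s, χ)` on `σ > 0` by partial summation). [MontgomeryVaughan2007]
-/

noncomputable section

open Complex Real Set MeasureTheory Filter Topology intervalIntegral
open Literature.NumberTheory.LFunctions.DirichletAbel (partialSum term abelSum)

namespace Literature.NumberTheory.LFunctions

namespace PutnamDirichlet

variable {q : ℕ} [NeZero q] {χ : DirichletCharacter ℂ q}

/-! ### Characters of the period circle (as in the `ζ` file, whose copies are private) -/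

/-- `e^{iπn} = e^{-iπn}` for an integer `n`. [folklore] -/
private theorem cexp_pi_mul_int (n : ℤ) : cexp (π * I * n) = cexp (-(π * I * n)) := by
  rw [Complex.exp_eq_exp_iff_exists_int]
  exact ⟨n, by ring⟩

/-- The characters of `AddCircle (2π/p)` along `ℝ`: `fourier (-n) x = e^{-inpx}`. [folklore] -/
private theorem fourier_neg_coe {p : ℝ} (hp : 0 < p) (n : ℤ) (x : ℝ) :
    fourier (-n) (x : AddCircle (π / p - -(π / p))) = cexp (-(I * n * p * x)) := by
  rw [fourier_coe_apply]
  congr 1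
  have hp' : (p : ℂ) ≠ 0 := by exact_mod_cast hp.ne'
  have hπ : (π : ℂ) ≠ 0 := by exact_mod_cast Real.pi_ne_zero
  push_cast
  field_simp
  ring

/-- `∫_{-π/p}^{π/p} e^{-inpx} dx = 0` for `n ≠ 0`. [folklore] -/
private theorem integral_cexp_eq_zero {p : ℝ} (hp : 0 < p) {n : ℤ} (hn : n ≠ 0) :
    ∫ x in (-(π / p))..(π / p), cexp (-(I * n * p * x)) = 0 := by
  have hc : (-(I * n * p) : ℂ) ≠ 0 := by
    have hp' : (p : ℂ) ≠ 0 := by exact_mod_cast hp.ne'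
    have hn' : (n : ℂ) ≠ 0 := by exact_mod_cast hn
    simp [hp', hn', I_ne_zero]
  have h := integral_exp_mul_complex (a := -(π / p)) (b := π / p) hc
  have h1 : (fun x : ℝ ↦ cexp (-(I * n * p) * x)) = fun x : ℝ ↦ cexp (-(I * n * p * x)) := by
    funext x; ring_nf
  rw [h1] at h
  rw [h]
  have hp' : (p : ℂ) ≠ 0 := by exact_mod_cast hp.ne'
  have e1 : (-(I * n * p) : ℂ) * ((π / p : ℝ) : ℂ) = -(π * I * n) := by
    push_cast; field_simp
  have e2 : (-(I * n * p) : ℂ) * ((-(π / p) : ℝ) : ℂ) = π * I * n := by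
    push_cast; field_simp
  rw [e1, e2, ← cexp_pi_mul_int n, sub_self, zero_div]

/-! ### The step function `g(y) = 𝟙_{y>0} S(⌊e^y⌋) e^{-Dy}` and its translates -/

/-- `‖g(y)‖ ≤ q e^{-Dy}` (`|S| ≤ q`, MV (4.23)). [cite: MontgomeryVaughan2007, §4.3 eq. (4.23)] -/
private theorem norm_g_le (hχ : χ ≠ 1) {D : ℝ} {g : ℝ → ℂ}
    (hg : ∀ y, g y = if 0 < y then partialSum χ ⌊rexp y⌋₊ * (rexp (-(D * y)) : ℂ) else 0)
    (y : ℝ) : ‖g y‖ ≤ q * rexp (-(D * y)) := by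
  rw [hg]
  split_ifs
  · rw [norm_mul, Complex.norm_real, Real.norm_eq_abs, abs_of_pos (Real.exp_pos _)]
    exact mul_le_mul_of_nonneg_right (DirichletAbel.norm_partialSum_le χ hχ _) (Real.exp_pos _).le
  · rw [norm_zero]; positivity

omit [NeZero q] in
/-- `g` is measurable. [folklore] -/
private theorem measurable_g {D : ℝ} {g : ℝ → ℂ}
    (hg : ∀ y, g y = if 0 < y then partialSum χ ⌊rexp y⌋₊ * (rexp (-(D * y)) : ℂ) else 0) :
    Measurable g := by
  rw [show g = fun y ↦ if 0 < y then partialSum χ ⌊rexp y⌋₊ * (rexp (-(D * y)) : ℂ) else 0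
    from funext hg]
  refine Measurable.ite measurableSet_Ioi ?_ measurable_const
  refine Measurable.mul ?_ (Complex.measurable_ofReal.comp (by fun_prop))
  exact (measurable_from_nat (f := partialSum χ)).comp (Nat.measurable_floor.comp Real.measurable_exp)

/-- Geometric decay of the translates: `‖g(x + kL)‖ ≤ q e^{-Dx} (e^{-DL})^k`. [folklore] -/
private theorem norm_g_translate_le (hχ : χ ≠ 1) {D L : ℝ} {g : ℝ → ℂ}
    (hg : ∀ y, g y = if 0 < y then partialSum χ ⌊rexp y⌋₊ * (rexp (-(D * y)) : ℂ) else 0)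
    (x : ℝ) (k : ℕ) :
    ‖g (x + k * L)‖ ≤ q * rexp (-(D * x)) * rexp (-(D * L)) ^ k := by
  refine (norm_g_le hχ hg _).trans_eq ?_
  rw [mul_assoc, ← Real.exp_nat_mul, ← Real.exp_add]
  congr 2; ring

/-- The translates `k ↦ g(x + kL)` are summable (geometric majorant). [folklore] -/
private theorem summable_g_translate (hχ : χ ≠ 1) {D L : ℝ} (hD : 0 < D) (hL : 0 < L) {g : ℝ → ℂ}
    (hg : ∀ y, g y = if 0 < y then partialSum χ ⌊rexp y⌋₊ * (rexp (-(D * y)) : ℂ) else 0)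
    (x : ℝ) : Summable fun k : ℕ ↦ g (x + k * L) := by
  have hr : rexp (-(D * L)) < 1 := Real.exp_lt_one_iff.mpr (by nlinarith)
  refine Summable.of_norm_bounded ?_ (fun k ↦ norm_g_translate_le hχ hg x k)
  exact (summable_geometric_of_lt_one (Real.exp_pos _).le hr).mul_left _

/-- The translates-sum `Φ(x) = Σ_{k ≥ 0} g(x + kL)` is measurable. [folklore] -/
private theorem measurable_phi (hχ : χ ≠ 1) {D p : ℝ} (hD : 0 < D) (hp : 0 < p) {g : ℝ → ℂ}
    (hg : ∀ y, g y = if 0 < y then partialSum χ ⌊rexp y⌋₊ * (rexp (-(D * y)) : ℂ) else 0)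
    {Φ : ℝ → ℂ} (hΦ : ∀ x, Φ x = ∑' k : ℕ, g (x + k * (2 * π / p))) : Measurable Φ := by
  have hL : 0 < 2 * π / p := by positivity
  rw [show Φ = fun x ↦ ∑' k : ℕ, g (x + k * (2 * π / p)) from funext hΦ]
  refine measurable_of_tendsto_metrizable
    (f := fun N x ↦ ∑ k ∈ Finset.range N, g (x + k * (2 * π / p))) (fun N ↦ ?_) ?_
  · exact Finset.measurable_sum _ fun k _ ↦ (measurable_g hg).comp (measurable_id.add_const _)
  · exact tendsto_pi_nhds.mpr fun x ↦ (summable_g_translate hχ hD hL hg x).hasSum.tendsto_sum_nat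

/-- Bound for the translates-sum: `‖Φ(x)‖ ≤ q e^{-Dx}/(1 - e^{-DL})`. [folklore] -/
private theorem norm_phi_le (hχ : χ ≠ 1) {D p : ℝ} (hD : 0 < D) (hp : 0 < p) {g : ℝ → ℂ}
    (hg : ∀ y, g y = if 0 < y then partialSum χ ⌊rexp y⌋₊ * (rexp (-(D * y)) : ℂ) else 0)
    {Φ : ℝ → ℂ} (hΦ : ∀ x, Φ x = ∑' k : ℕ, g (x + k * (2 * π / p))) (x : ℝ) :
    ‖Φ x‖ ≤ q * rexp (-(D * x)) * (1 - rexp (-(D * (2 * π / p))))⁻¹ := by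
  have hL : 0 < 2 * π / p := by positivity
  have hr0 : 0 ≤ rexp (-(D * (2 * π / p))) := (Real.exp_pos _).le
  have hr1 : rexp (-(D * (2 * π / p))) < 1 := Real.exp_lt_one_iff.mpr (by nlinarith)
  have hs := summable_g_translate hχ hD hL hg x
  rw [hΦ x]
  refine (norm_tsum_le_tsum_norm hs.norm).trans ?_
  rw [← tsum_geometric_of_lt_one hr0 hr1, ← tsum_mul_left]
  exact hs.norm.tsum_le_tsum (fun k ↦ norm_g_translate_le hχ hg x k)
    ((summable_geometric_of_lt_one hr0 hr1).mul_left _)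

/-! ### The Mellin side: `L(s, χ)/s = ∫_0^∞ S(⌊e^y⌋) e^{-sy} dy` -/

omit [NeZero q] in
/-- `(m+1)^{-s} = e^{-s log(m+1)}`. [folklore] -/
private theorem natCast_succ_cpow_neg (m : ℕ) (s : ℂ) :
    ((m + 1 : ℕ) : ℂ) ^ (-s) = cexp (-(s * (Real.log ((m : ℝ) + 1) : ℝ))) := by
  have hpos : (0 : ℝ) < (m : ℝ) + 1 := by positivity
  have e1 : ((m + 1 : ℕ) : ℂ) = (((m : ℝ) + 1 : ℝ) : ℂ) := by push_cast; ring
  rw [e1, Complex.cpow_def_of_ne_zero (by exact_mod_cast hpos.ne'), ← Complex.ofReal_log hpos.le]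
  congr 1; ring

/-- **Mellin form of the Abel transform.** For `χ ≠ χ₀` and `Re s > 0`,
`∫_0^∞ S(⌊e^y⌋) e^{-sy} dy = A_χ(s)/s`, where `A_χ(s) = Σ_{m ≥ 1} S(m)(m^{-s} − (m+1)^{-s})`
(`= L(s, χ)`, MV Thm. 4.8): on `[log m, log(m+1))` the integrand is `S(m) e^{-sy}`.
[cite: MontgomeryVaughan2007, §4.3 Thm. 4.8; §1.3 Thm. 1.3] -/
private theorem integral_step_eq (hχ : χ ≠ 1) {s : ℂ} (hs : 0 < s.re) :
    ∫ y in Ioi (0 : ℝ), partialSum χ ⌊rexp y⌋₊ * cexp (-(s * y)) = abelSum χ s / s := by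
  set h : ℝ → ℂ := fun y ↦ partialSum χ ⌊rexp y⌋₊ * cexp (-(s * y)) with hh
  set a : ℕ → ℝ := fun m ↦ Real.log ((m : ℝ) + 1) with ha
  have ha0 : a 0 = 0 := by simp [ha]
  have ha_nonneg : ∀ m : ℕ, 0 ≤ a m := fun m ↦ Real.log_nonneg (by norm_cast; omega)
  have ha_mono : ∀ m : ℕ, a m ≤ a (m + 1) := fun m ↦
    Real.log_le_log (by positivity) (by push_cast; linarith)
  have ha_tend : Tendsto a atTop atTop :=
    Real.tendsto_log_atTop.comp (tendsto_atTop_add_const_right _ 1 tendsto_natCast_atTop_atTop)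
  have hs0 : s ≠ 0 := fun h0 ↦ by rw [h0] at hs; simp at hs
  -- integrability on `(0, ∞)`
  have hh_meas : Measurable h := by
    refine Measurable.mul ?_ (by fun_prop)
    exact (measurable_from_nat (f := partialSum χ)).comp (Nat.measurable_floor.comp Real.measurable_exp)
  have hh_norm : ∀ y : ℝ, ‖h y‖ ≤ q * rexp (-s.re * y) := by
    intro y
    rw [hh]; dsimp only
    rw [norm_mul, Complex.norm_exp]
    have hre : (-(s * (y : ℂ))).re = -s.re * y := by
      simp [Complex.mul_re, Complex.ofReal_re, Complex.ofReal_im]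
    rw [hre]
    exact mul_le_mul_of_nonneg_right (DirichletAbel.norm_partialSum_le χ hχ _) (Real.exp_pos _).le
  have hh_int : IntegrableOn h (Ioi 0) := by
    refine Integrable.mono' ((exp_neg_integrableOn_Ioi 0 hs).const_mul (q : ℝ))
      hh_meas.aestronglyMeasurable (ae_of_all _ fun y ↦ hh_norm y)
  -- the piece `[log(m+1), log(m+2)]`
  have hfloor : ∀ m : ℕ, ∀ y ∈ Ioo (a m) (a (m + 1)), ⌊rexp y⌋₊ = m + 1 := by
    intro m y hy
    rw [Nat.floor_eq_iff (Real.exp_pos _).le]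
    have h1 : rexp (a m) < rexp y := Real.exp_lt_exp.mpr hy.1
    have h2 : rexp y < rexp (a (m + 1)) := Real.exp_lt_exp.mpr hy.2
    rw [ha] at h1 h2
    dsimp only at h1 h2
    rw [Real.exp_log (by positivity)] at h1 h2
    push_cast at h1 h2 ⊢
    constructor <;> linarith
  have hpiece : ∀ m : ℕ, ∫ y in a m..a (m + 1), h y = term χ m s / s := by
    intro m
    have hab : a m ≤ a (m + 1) := ha_mono m
    have hcongr : ∫ y in a m..a (m + 1), h y =
        ∫ y in a m..a (m + 1), partialSum χ (m + 1) * cexp (-(s * y)) := by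
      refine intervalIntegral.integral_congr_ae ?_
      have hne : ∀ᵐ y ∂(volume : Measure ℝ), y ∉ ({a (m + 1)} : Set ℝ) :=
        measure_eq_zero_iff_ae_notMem.mp (measure_singleton _)
      filter_upwards [hne] with y hy hyI
      rw [uIoc_of_le hab] at hyI
      have hy' : y ∈ Ioo (a m) (a (m + 1)) := ⟨hyI.1, lt_of_le_of_ne hyI.2 (by simpa using hy)⟩
      rw [hh]; dsimp only
      rw [hfloor m y hy']
    rw [hcongr, intervalIntegral.integral_const_mul]
    have hI : ∫ y in a m..a (m + 1), cexp (-(s * y)) =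
        (((m + 1 : ℕ) : ℂ) ^ (-s) - ((m + 1 + 1 : ℕ) : ℂ) ^ (-s)) / s := by
      have h1 := integral_exp_mul_complex (a := a m) (b := a (m + 1)) (neg_ne_zero.mpr hs0)
      have e0 : (fun y : ℝ ↦ cexp (-s * (y : ℂ))) = fun y : ℝ ↦ cexp (-(s * y)) := by
        funext y; rw [neg_mul]
      rw [e0] at h1
      rw [h1, natCast_succ_cpow_neg m s, natCast_succ_cpow_neg (m + 1) s]
      rw [ha]; dsimp only
      push_cast
      field_simp
      ring_nf
    rw [hI, DirichletAbel.term]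
    ring
  -- partial sums of pieces = integral up to `a M`
  have hpartial : ∀ M : ℕ, ∫ y in (0 : ℝ)..a M, h y = ∑ m ∈ Finset.range M, term χ m s / s := by
    intro M
    have hii : ∀ k < M, IntervalIntegrable h volume (a k) (a (k + 1)) := by
      intro k _
      refine intervalIntegrable_iff.mpr (hh_int.mono_set ?_)
      rw [uIoc_of_le (ha_mono k)]
      exact fun y hy ↦ lt_of_le_of_lt (ha_nonneg k) hy.1
    rw [← ha0, ← intervalIntegral.sum_integral_adjacent_intervals hii]
    exact Finset.sum_congr rfl fun m _ ↦ hpiece m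
  have h1 : Tendsto (fun M : ℕ ↦ ∫ y in (0 : ℝ)..a M, h y) atTop (𝓝 (∫ y in Ioi 0, h y)) :=
    intervalIntegral_tendsto_integral_Ioi 0 hh_int ha_tend
  have h2 : Tendsto (fun M : ℕ ↦ ∑ m ∈ Finset.range M, term χ m s / s) atTop
      (𝓝 (abelSum χ s / s)) := by
    have := (DirichletAbel.summable_term χ hχ hs).hasSum.tendsto_sum_nat
    simp_rw [div_eq_mul_inv, ← Finset.sum_mul]
    exact this.mul_const _
  simp_rw [hpartial] at h1
  exact tendsto_nhds_unique h1 h2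

/-- The zero-side input: for `χ ≠ χ₀`, `D > 0` and `s = D + inp`,
`∫_0^∞ e^{-inpy} g(y) dy = L(s, χ)/s`. [cite: MontgomeryVaughan2007, §4.3 Thm. 4.8] -/
private theorem integral_cexp_mul_g (hχ : χ ≠ 1) {D p : ℝ} (hD : 0 < D) {g : ℝ → ℂ}
    (hg : ∀ y, g y = if 0 < y then partialSum χ ⌊rexp y⌋₊ * (rexp (-(D * y)) : ℂ) else 0)
    (n : ℤ) :
    ∫ y in Ioi (0 : ℝ), cexp (-(I * n * p * y)) * g y =
      χ.LFunction (D + I * n * p) / (D + I * n * p) := by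
  set s : ℂ := D + I * n * p with hs
  have hsre : 0 < s.re := by simpa [hs] using hD
  rw [DirichletAbel.LFunction_eq_abelSum χ hχ hsre, ← integral_step_eq hχ hsre]
  refine setIntegral_congr_fun measurableSet_Ioi fun y hy ↦ ?_
  rw [hg y, if_pos (mem_Ioi.mp hy)]
  rw [show cexp (-(s * y)) = cexp (-(I * n * p * y)) * (rexp (-(D * y)) : ℂ) by
    rw [Complex.ofReal_exp, ← Complex.exp_add]; congr 1; rw [hs]; push_cast; ring]
  ring

/-- **Fourier coefficients of the translates-sum.** With `b = π/p`, `L = 2b` and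
`Φ(x) = Σ_{k≥0} g(x + kL)`: `∫_{-b}^{b} e^{-inpx} Φ(x) dx = ∫_0^∞ e^{-inpy} g(y) dy`
(unrolling the translates tiles `(-b, ∞)`; `g` vanishes on `(-b, 0]`). [folklore] -/
private theorem integral_cexp_mul_phi (hχ : χ ≠ 1) {D p : ℝ} (hD : 0 < D) (hp : 0 < p) {g : ℝ → ℂ}
    (hg : ∀ y, g y = if 0 < y then partialSum χ ⌊rexp y⌋₊ * (rexp (-(D * y)) : ℂ) else 0)
    {Φ : ℝ → ℂ} (hΦ : ∀ x, Φ x = ∑' k : ℕ, g (x + k * (2 * π / p))) (n : ℤ) :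
    ∫ x in (-(π / p))..(π / p), cexp (-(I * n * p * x)) * Φ x =
      ∫ y in Ioi (0 : ℝ), cexp (-(I * n * p * y)) * g y := by
  set b : ℝ := π / p with hb
  have hb0 : 0 < b := div_pos Real.pi_pos hp
  have hL : 2 * π / p = 2 * b := by rw [hb]; ring
  set e : ℝ → ℂ := fun x ↦ cexp (-(I * n * p * x)) with he
  have he_norm : ∀ x, ‖e x‖ = 1 := fun x ↦ by
    rw [he]; dsimp only
    rw [Complex.norm_exp]; simp
  have he_cont : Continuous e := by rw [he]; fun_prop
  have he_per : ∀ (x : ℝ) (k : ℕ), e (x + k * (2 * b)) = e x := by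
    intro x k
    rw [he]; dsimp only
    have h2 : -(I * n * p * ((x + k * (2 * b) : ℝ) : ℂ)) =
        -(I * n * p * x) + ((-(n * k : ℤ)) : ℤ) * (2 * π * I) := by
      rw [hb]; push_cast
      have hp' : (p : ℂ) ≠ 0 := by exact_mod_cast hp.ne'
      field_simp; ring
    rw [h2, Complex.exp_add, Complex.exp_int_mul_two_pi_mul_I, mul_one]
  set r : ℝ := rexp (-(D * (2 * b))) with hr
  have hr0 : 0 ≤ r := (Real.exp_pos _).le
  have hr1 : r < 1 := Real.exp_lt_one_iff.mpr (by nlinarith)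
  have hgm : Measurable g := measurable_g hg
  -- the terms `F k x = e(x) g(x + kL)` and their integrals
  set F : ℕ → ℝ → ℂ := fun k x ↦ e x * g (x + k * (2 * b)) with hF
  have hF_meas : ∀ k, Measurable (F k) := fun k ↦ by
    rw [hF]
    exact he_cont.measurable.mul (hgm.comp (measurable_id.add_const _))
  have hF_norm : ∀ k x, -b ≤ x → ‖F k x‖ ≤ q * rexp (D * b) * r ^ k := fun k x hx ↦ by
    rw [hF]; dsimp only
    rw [norm_mul, he_norm, one_mul]
    refine (norm_g_translate_le hχ hg x k).trans ?_
    rw [hr]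
    gcongr
    nlinarith
  haveI hfin : IsFiniteMeasure (volume.restrict (Ioc (-b) b)) :=
    isFiniteMeasure_restrict.mpr measure_Ioc_lt_top.ne
  have hF_int : ∀ k, Integrable (F k) (volume.restrict (Ioc (-b) b)) := fun k ↦ by
    refine Integrable.mono' (integrable_const (q * rexp (D * b) * r ^ k))
      (hF_meas k).aestronglyMeasurable ?_
    rw [ae_restrict_iff' measurableSet_Ioc]
    exact ae_of_all _ fun x hx ↦ hF_norm k x hx.1.le
  have hvol : volume.real (Ioc (-b) b) = 2 * b := by
    rw [measureReal_def, Real.volume_Ioc, ENNReal.toReal_ofReal (by linarith)]; ring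
  have hF_sum : Summable fun k ↦ ∫ x in Ioc (-b) b, ‖F k x‖ := by
    refine Summable.of_nonneg_of_le (fun k ↦ integral_nonneg fun x ↦ norm_nonneg _)
      (fun k ↦ ?_) ((summable_geometric_of_lt_one hr0 hr1).mul_left (q * rexp (D * b) * (2 * b)))
    calc ∫ x in Ioc (-b) b, ‖F k x‖ ≤ ∫ x in Ioc (-b) b, q * rexp (D * b) * r ^ k := by
          refine setIntegral_mono_on (hF_int k).norm (integrableOn_const ?_) measurableSet_Ioc
            fun x hx ↦ hF_norm k x hx.1.le
          exact measure_Ioc_lt_top.ne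
      _ = q * rexp (D * b) * (2 * b) * r ^ k := by
          rw [setIntegral_const, hvol, smul_eq_mul]; ring
  -- Step 1: interchange sum and integral
  have step1 : ∫ x in (-b)..b, e x * Φ x = ∑' k, ∫ x in (-b)..b, F k x := by
    simp_rw [intervalIntegral.integral_of_le (by linarith : -b ≤ b)]
    rw [integral_tsum_of_summable_integral_norm hF_int hF_sum]
    refine setIntegral_congr_fun measurableSet_Ioc fun x _ ↦ ?_
    rw [hΦ x, hL, ← tsum_mul_left]
  -- Step 2: each term is the integral of `e g` over the translated interval
  have step2 : ∀ k : ℕ, ∫ x in (-b)..b, F k x =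
      ∫ y in (-b + k * (2 * b))..(-b + (k + 1 : ℕ) * (2 * b)), e y * g y := by
    intro k
    have h := intervalIntegral.integral_comp_add_right (a := -b) (b := b)
      (fun y ↦ e y * g y) (k * (2 * b))
    rw [show b + k * (2 * b) = -b + (k + 1 : ℕ) * (2 * b) by push_cast; ring] at h
    rw [← h]
    refine intervalIntegral.integral_congr fun x _ ↦ ?_
    show e x * g (x + k * (2 * b)) = e (x + k * (2 * b)) * g (x + k * (2 * b))
    rw [he_per]
  -- Step 3: the translated intervals tile `(-b, ∞)`
  have heg_int : IntegrableOn (fun y ↦ e y * g y) (Ioi (-b)) := by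
    refine Integrable.mono' ((exp_neg_integrableOn_Ioi (-b) hD).const_mul (q : ℝ)) ?_ ?_
    · exact (he_cont.measurable.mul hgm).aestronglyMeasurable
    · refine ae_of_all _ fun y ↦ ?_
      rw [norm_mul, he_norm, one_mul]
      simpa [neg_mul] using norm_g_le hχ hg y
  have step3 : ∑' k : ℕ, ∫ y in (-b + k * (2 * b))..(-b + (k + 1 : ℕ) * (2 * b)), e y * g y =
      ∫ y in Ioi (-b), e y * g y := by
    have hpartial : ∀ N : ℕ, ∑ k ∈ Finset.range N,
        ∫ y in (-b + k * (2 * b))..(-b + (k + 1 : ℕ) * (2 * b)), e y * g y =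
        ∫ y in (-b)..(-b + (N : ℕ) * (2 * b)), e y * g y := by
      intro N
      have hii : ∀ k < N, IntervalIntegrable (fun y ↦ e y * g y) volume
          ((fun k : ℕ ↦ -b + k * (2 * b)) k) ((fun k : ℕ ↦ -b + k * (2 * b)) (k + 1)) := by
        intro k _
        have hle : -b + (k : ℝ) * (2 * b) ≤ -b + ((k + 1 : ℕ) : ℝ) * (2 * b) := by
          push_cast; nlinarith
        refine intervalIntegrable_iff.mpr (heg_int.mono_set ?_)
        rw [uIoc_of_le hle]
        refine fun y hy ↦ lt_of_le_of_lt ?_ hy.1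
        have : (0 : ℝ) ≤ (k : ℝ) * (2 * b) := by positivity
        linarith
      have h := intervalIntegral.sum_integral_adjacent_intervals hii
      simpa using h
    have hJsum : Summable fun k : ℕ ↦
        ∫ y in (-b + k * (2 * b))..(-b + (k + 1 : ℕ) * (2 * b)), e y * g y := by
      have : ∀ k : ℕ, ∫ y in (-b + k * (2 * b))..(-b + (k + 1 : ℕ) * (2 * b)), e y * g y =
          ∫ x in (-b)..b, F k x := fun k ↦ (step2 k).symm
      simp_rw [this, intervalIntegral.integral_of_le (by linarith : -b ≤ b)]
      exact Summable.of_norm_bounded hF_sum fun k ↦ norm_integral_le_integral_norm _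
    have htend : Tendsto (fun N : ℕ ↦ ∑ k ∈ Finset.range N,
        ∫ y in (-b + k * (2 * b))..(-b + (k + 1 : ℕ) * (2 * b)), e y * g y) atTop
        (𝓝 (∫ y in Ioi (-b), e y * g y)) := by
      simp_rw [hpartial]
      refine intervalIntegral_tendsto_integral_Ioi (-b) heg_int ?_
      refine tendsto_atTop_add_const_left _ _ ?_
      exact tendsto_natCast_atTop_atTop.atTop_mul_const (by linarith)
    exact tendsto_nhds_unique hJsum.hasSum.tendsto_sum_nat htend
  -- Step 4: `g` vanishes on `(-b, 0]`
  have step4 : ∫ y in Ioi (-b), e y * g y = ∫ y in Ioi (0 : ℝ), e y * g y := by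
    rw [← Ioc_union_Ioi_eq_Ioi (by linarith : -b ≤ 0),
      setIntegral_union (Set.Ioc_disjoint_Ioi le_rfl) measurableSet_Ioi
        (heg_int.mono_set Ioc_subset_Ioi_self) (heg_int.mono_set (Ioi_subset_Ioi (by linarith))),
      setIntegral_eq_zero_of_forall_eq_zero fun y hy ↦ by
        rw [hg y, if_neg (not_lt.mpr hy.2)]; simp, zero_add]
  rw [step1]
  simp_rw [step2]
  rw [step3, step4]

/-! ### Vanishing Fourier coefficients and Parseval: `Φ` is a.e. constant -/

/-- **Putnam's Fourier-series step for `L(s, χ)`.** If `χ ≠ χ₀` and `L(D + inp, χ) = 0` for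
every integer `n ≠ 0` (`D > 0`, `p > 0`), then the translates-sum `Φ` has all non-constant
Fourier coefficients on the period interval `(-π/p, π/p]` equal to zero, hence (Parseval) is
a.e. equal to a constant there.
[cite: Putnam1954, pp. 97–99; LapidusVanfrankenhuijsen2006, Theorem 11.17] -/
theorem ae_eq_const (hχ : χ ≠ 1) {D p : ℝ} (hD0 : 0 < D) (hp : 0 < p) {g Φ : ℝ → ℂ}
    (hg : ∀ y, g y = if 0 < y then partialSum χ ⌊rexp y⌋₊ * (rexp (-(D * y)) : ℂ) else 0)
    (hΦ : ∀ x, Φ x = ∑' k : ℕ, g (x + k * (2 * π / p)))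
    (hzero : ∀ n : ℤ, n ≠ 0 → χ.LFunction (D + I * n * p) = 0) :
    ∃ c : ℂ, ∀ᵐ x ∂(volume.restrict (Ioc (-(π / p)) (π / p))), Φ x = c := by
  have hb0 : 0 < π / p := div_pos Real.pi_pos hp
  have hab : -(π / p) < π / p := by linarith
  have hΦm : Measurable Φ := measurable_phi hχ hD0 hp hg hΦ
  -- a uniform bound on the period interval
  obtain ⟨M, hM⟩ : ∃ M : ℝ, ∀ x ∈ Ioc (-(π / p)) (π / p), ‖Φ x‖ ≤ M := by
    refine ⟨q * rexp (D * (π / p)) * (1 - rexp (-(D * (2 * π / p))))⁻¹, fun x hx ↦ ?_⟩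
    have hr1 : rexp (-(D * (2 * π / p))) < 1 :=
      Real.exp_lt_one_iff.mpr (neg_lt_zero.mpr (by positivity))
    refine (norm_phi_le hχ hD0 hp hg hΦ x).trans ?_
    refine mul_le_mul_of_nonneg_right ?_ (inv_nonneg.mpr (by linarith))
    refine mul_le_mul_of_nonneg_left (Real.exp_le_exp.mpr ?_) (Nat.cast_nonneg _)
    have : 0 ≤ D * (x + π / p) := mul_nonneg hD0.le (by linarith [hx.1])
    linarith
  set c : ℂ := (1 / (2 * (π / p)) : ℝ) * ∫ x in (-(π / p))..(π / p), Φ x with hc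
  set F : ℝ → ℂ := fun x ↦ Φ x - c with hF
  have hFm : Measurable F := hΦm.sub_const c
  have hF_bdd : ∀ x ∈ Ioc (-(π / p)) (π / p), ‖F x‖ ≤ M + ‖c‖ := fun x hx ↦ by
    rw [hF]; dsimp only
    exact (norm_sub_le _ _).trans (add_le_add (hM x hx) le_rfl)
  haveI hfin : IsFiniteMeasure (volume.restrict (Ioc (-(π / p)) (π / p))) :=
    isFiniteMeasure_restrict.mpr measure_Ioc_lt_top.ne
  have hL2 : MemLp F 2 (volume.restrict (Ioc (-(π / p)) (π / p))) :=
    MemLp.of_bound hFm.aestronglyMeasurable (M + ‖c‖)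
      (by rw [ae_restrict_iff' measurableSet_Ioc]; exact ae_of_all _ hF_bdd)
  -- interval integrability against the characters
  have hii : ∀ n : ℤ,
      IntervalIntegrable (fun x ↦ cexp (-(I * n * p * x)) * Φ x) volume (-(π / p)) (π / p) := by
    intro n
    rw [intervalIntegrable_iff, uIoc_of_le hab.le]
    refine Integrable.mono' (integrable_const M) ?_ ?_
    · exact ((by fun_prop : Continuous fun x : ℝ ↦ cexp (-(I * n * p * x))).measurable.mul
        hΦm).aestronglyMeasurable
    · rw [ae_restrict_iff' measurableSet_Ioc]
      refine ae_of_all _ fun x hx ↦ ?_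
      rw [norm_mul, Complex.norm_exp]
      simp only [neg_re, mul_re, I_re, zero_mul, I_im, one_mul, intCast_re,
        ofReal_re, intCast_im, ofReal_im, mul_zero, sub_zero, mul_im,
        neg_zero, Real.exp_zero, zero_add]
      simpa using hM x hx
  -- all Fourier coefficients of `F` on the period interval vanish
  have hcoeff : ∀ n : ℤ, fourierCoeffOn hab F n = 0 := by
    intro n
    rw [fourierCoeffOn_eq_integral, smul_eq_zero]
    refine Or.inr ?_
    have hchar : ∀ x : ℝ, fourier (-n) (x : AddCircle (π / p - -(π / p))) • F x =
        cexp (-(I * n * p * x)) * Φ x - c * cexp (-(I * n * p * x)) := by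
      intro x
      rw [fourier_neg_coe hp, smul_eq_mul, hF]
      ring
    simp_rw [hchar]
    rw [intervalIntegral.integral_sub (hii n)
        ((Continuous.intervalIntegrable (by fun_prop) _ _).const_mul c),
      intervalIntegral.integral_const_mul]
    by_cases hn : n = 0
    · -- the constant term: this is the choice of `c`
      subst hn
      have h1 : ∀ x : ℝ, cexp (-(I * ((0 : ℤ) : ℂ) * p * x)) = 1 := fun x ↦ by simp
      simp only [h1, one_mul, intervalIntegral.integral_const, Complex.real_smul, mul_one]
      rw [hc]
      have hp' : (p : ℂ) ≠ 0 := by exact_mod_cast hp.ne'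
      have hπ : (π : ℂ) ≠ 0 := by exact_mod_cast Real.pi_ne_zero
      push_cast
      field_simp
      ring
    · -- `n ≠ 0`: the coefficient is `L(s_n, χ)/s_n = 0`
      rw [integral_cexp_mul_phi hχ hD0 hp hg hΦ n, integral_cexp_mul_g hχ hD0 hg n,
        integral_cexp_eq_zero hp hn, mul_zero, sub_zero, hzero n hn, zero_div]
  -- Parseval
  have hP := tsum_sq_fourierCoeffOn hab hL2
  simp only [hcoeff, norm_zero, ne_eq, OfNat.ofNat_ne_zero, not_false_eq_true, zero_pow,
    tsum_zero] at hP
  have hint0 : ∫ x in (-(π / p))..(π / p), ‖F x‖ ^ 2 = 0 := by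
    have h2b : (π / p - -(π / p))⁻¹ ≠ 0 := inv_ne_zero (by linarith)
    rw [smul_eq_mul] at hP
    exact (mul_eq_zero.mp hP.symm).resolve_left h2b
  have hFi2 : IntervalIntegrable (fun x ↦ ‖F x‖ ^ 2) volume (-(π / p)) (π / p) := by
    rw [intervalIntegrable_iff, uIoc_of_le hab.le]
    refine Integrable.mono' (integrable_const ((M + ‖c‖) ^ 2)) ?_ ?_
    · exact ((continuous_norm.measurable.comp hFm).pow_const 2).aestronglyMeasurable
    · rw [ae_restrict_iff' measurableSet_Ioc]
      refine ae_of_all _ fun x hx ↦ ?_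
      rw [Real.norm_eq_abs, abs_of_nonneg (by positivity)]
      have h0 : 0 ≤ ‖F x‖ := norm_nonneg _
      have := hF_bdd x hx
      nlinarith
  have hae := (intervalIntegral.integral_eq_zero_iff_of_le_of_nonneg_ae hab.le
    (ae_of_all _ fun x ↦ by positivity) hFi2).mp hint0
  refine ⟨c, ?_⟩
  filter_upwards [hae] with x hx
  have hx0 : F x = 0 := by simpa using hx
  rw [hF] at hx0
  exact sub_eq_zero.mp hx0

/-! ### The jump at `0` -/

omit [NeZero q] in
/-- **Right limits at the lattice points.** For `x_j ↓ 0` (`x_j > 0`) and `k ≥ 0`,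
`g(x_j + kL) → S(⌊e^{kL}⌋) e^{-DkL}` (the floor `⌊e^{x_j + kL}⌋ = ⌊e^{kL}⌋` eventually).
[folklore] -/
private theorem tendsto_g_right {D L : ℝ} (hL : 0 < L) {g : ℝ → ℂ}
    (hg : ∀ y, g y = if 0 < y then partialSum χ ⌊rexp y⌋₊ * (rexp (-(D * y)) : ℂ) else 0)
    {x : ℕ → ℝ} (hx : ∀ j, 0 < x j) (hx0 : Tendsto x atTop (𝓝 0)) (k : ℕ) :
    Tendsto (fun j ↦ g (x j + k * L)) atTop
      (𝓝 (partialSum χ ⌊rexp (k * L)⌋₊ * (rexp (-(D * (k * L))) : ℂ))) := by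
  set u0 : ℝ := rexp (k * L) with hu0
  have hkL : 0 ≤ (k : ℝ) * L := by positivity
  have ht : Tendsto (fun j ↦ rexp (x j + k * L)) atTop (𝓝 u0) := by
    have hc : Continuous fun t : ℝ ↦ rexp (t + k * L) := by fun_prop
    have := (hc.tendsto 0).comp hx0
    simpa [hu0, Function.comp_def] using this
  have hfloor : ∀ᶠ j in atTop, ⌊rexp (x j + k * L)⌋₊ = ⌊u0⌋₊ := by
    have hlt : ∀ᶠ j in atTop, rexp (x j + k * L) < ⌊u0⌋₊ + 1 :=
      (tendsto_order.1 ht).2 _ (Nat.lt_floor_add_one u0)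
    filter_upwards [hlt] with j hj
    rw [Nat.floor_eq_iff (Real.exp_pos _).le]
    refine ⟨(Nat.floor_le (Real.exp_pos _).le).trans ?_, hj⟩
    exact Real.exp_le_exp.mpr (by linarith [hx j])
  have heq : ∀ᶠ j in atTop, partialSum χ ⌊u0⌋₊ * (rexp (-(D * (x j + k * L))) : ℂ) =
      g (x j + k * L) := by
    filter_upwards [hfloor] with j hj
    rw [hg, if_pos (by linarith [hx j]), hj]
  refine Tendsto.congr' heq ?_
  refine tendsto_const_nhds.mul ?_
  have hc : Continuous fun t : ℝ ↦ ((rexp (-(D * (t + k * L))) : ℝ) : ℂ) := by fun_prop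
  have := (hc.tendsto 0).comp hx0
  simpa [Function.comp_def] using this

omit [NeZero q] in
/-- **Left limits at the lattice points.** For `y_j ↑ 0` (`y_j < 0`) and `k ≥ 0`,
`g(y_j + kL) → S(⌈e^{kL}⌉ - 1) e^{-DkL}` (for `k ≥ 1` the floor `⌊e^{y_j + kL}⌋ = ⌈e^{kL}⌉ - 1`
eventually; for `k = 0` both sides vanish). [folklore] -/
private theorem tendsto_g_left {D L : ℝ} (hL : 0 < L) {g : ℝ → ℂ}
    (hg : ∀ y, g y = if 0 < y then partialSum χ ⌊rexp y⌋₊ * (rexp (-(D * y)) : ℂ) else 0)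
    {y : ℕ → ℝ} (hy : ∀ j, y j < 0) (hy0 : Tendsto y atTop (𝓝 0)) (k : ℕ) :
    Tendsto (fun j ↦ g (y j + k * L)) atTop
      (𝓝 (partialSum χ (⌈rexp (k * L)⌉₊ - 1) * (rexp (-(D * (k * L))) : ℂ))) := by
  rcases Nat.eq_zero_or_pos k with rfl | hk
  · -- `k = 0`: `g(y_j) = 0` and `⌈1⌉ - 1 = 0`, `S(0) = 0`
    have h0 : ∀ j, g (y j + ((0 : ℕ) : ℝ) * L) = 0 := fun j ↦ by
      rw [hg, if_neg (by push_cast; linarith [hy j])]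
    have htarget : partialSum χ (⌈rexp (((0 : ℕ) : ℝ) * L)⌉₊ - 1) *
        (rexp (-(D * (((0 : ℕ) : ℝ) * L))) : ℂ) = 0 := by simp
    rw [htarget]
    exact (tendsto_congr h0).mpr tendsto_const_nhds
  · set u0 : ℝ := rexp (k * L) with hu0
    have hkL : 0 < (k : ℝ) * L := by positivity
    have hu0pos : 0 < u0 := Real.exp_pos _
    have hceil1 : 1 ≤ ⌈u0⌉₊ := Nat.one_le_iff_ne_zero.mpr (Nat.pos_iff_ne_zero.mp (Nat.ceil_pos.mpr hu0pos))
    set n : ℕ := ⌈u0⌉₊ - 1 with hn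
    have hncast : (n : ℝ) = ⌈u0⌉₊ - 1 := by rw [hn, Nat.cast_sub hceil1, Nat.cast_one]
    have hn_lt : (n : ℝ) < u0 := by
      rw [hncast]; linarith [Nat.ceil_lt_add_one hu0pos.le]
    have hn1 : u0 ≤ (n : ℝ) + 1 := by rw [hncast]; linarith [Nat.le_ceil u0]
    have ht : Tendsto (fun j ↦ rexp (y j + k * L)) atTop (𝓝 u0) := by
      have hc : Continuous fun t : ℝ ↦ rexp (t + k * L) := by fun_prop
      have := (hc.tendsto 0).comp hy0
      simpa [hu0, Function.comp_def] using this
    have hpos : ∀ᶠ j in atTop, 0 < y j + k * L := by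
      have : ∀ᶠ j in atTop, -(k * L) < y j := (tendsto_order.1 hy0).1 _ (by linarith)
      filter_upwards [this] with j hj
      linarith
    have hfloor : ∀ᶠ j in atTop, ⌊rexp (y j + k * L)⌋₊ = n := by
      have hgt : ∀ᶠ j in atTop, (n : ℝ) < rexp (y j + k * L) := (tendsto_order.1 ht).1 _ hn_lt
      filter_upwards [hgt] with j hj
      rw [Nat.floor_eq_iff (Real.exp_pos _).le]
      refine ⟨hj.le, lt_of_lt_of_le ?_ hn1⟩
      exact Real.exp_lt_exp.mpr (by linarith [hy j])
    have heq : ∀ᶠ j in atTop, partialSum χ n * (rexp (-(D * (y j + k * L))) : ℂ) =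
        g (y j + k * L) := by
      filter_upwards [hfloor, hpos] with j hj hj'
      rw [hg, if_pos hj', hj]
    refine Tendsto.congr' heq ?_
    refine tendsto_const_nhds.mul ?_
    have hc : Continuous fun t : ℝ ↦ ((rexp (-(D * (t + k * L))) : ℝ) : ℂ) := by fun_prop
    have := (hc.tendsto 0).comp hy0
    simpa [Function.comp_def] using this

/-- **The jump of `Φ` at `0` (Tannery).** For `x_j ↓ 0`, `y_j ↑ 0` inside the period interval,
`Φ(x_j) − Φ(y_j) → Σ_k (S(⌊e^{kL}⌋) − S(⌈e^{kL}⌉ − 1)) e^{−DkL}`, `L = 2π/p`. [folklore] -/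
private theorem tendsto_phi_sub_phi (hχ : χ ≠ 1) {D p : ℝ} (hD0 : 0 < D) (hp : 0 < p)
    {g Φ : ℝ → ℂ}
    (hg : ∀ y, g y = if 0 < y then partialSum χ ⌊rexp y⌋₊ * (rexp (-(D * y)) : ℂ) else 0)
    (hΦ : ∀ x, Φ x = ∑' k : ℕ, g (x + k * (2 * π / p)))
    {x y : ℕ → ℝ} (hx : ∀ j, x j ∈ Ioo 0 (π / p)) (hy : ∀ j, y j ∈ Ioo (-(π / p)) 0)
    (hx0 : Tendsto x atTop (𝓝 0)) (hy0 : Tendsto y atTop (𝓝 0)) :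
    Tendsto (fun j ↦ Φ (x j) - Φ (y j)) atTop
      (𝓝 (∑' k : ℕ, (partialSum χ ⌊rexp (k * (2 * π / p))⌋₊ -
          partialSum χ (⌈rexp (k * (2 * π / p))⌉₊ - 1)) *
        (rexp (-(D * (k * (2 * π / p)))) : ℂ))) := by
  set L : ℝ := 2 * π / p with hLdef
  have hL : 0 < L := by positivity
  have hb0 : 0 < π / p := div_pos Real.pi_pos hp
  have hbL : π / p ≤ L := by
    rw [hLdef, le_div_iff₀ hp, div_mul_cancel₀ _ hp.ne']; linarith [Real.pi_pos]
  set r : ℝ := rexp (-(D * L)) with hr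
  have hr0 : 0 ≤ r := (Real.exp_pos _).le
  have hr1 : r < 1 := Real.exp_lt_one_iff.mpr (by nlinarith)
  -- rewrite the difference as one series
  have hdiff : ∀ j, Φ (x j) - Φ (y j) = ∑' k : ℕ, (g (x j + k * L) - g (y j + k * L)) := fun j ↦ by
    rw [hΦ, hΦ, ← (summable_g_translate hχ hD0 hL hg _).tsum_sub (summable_g_translate hχ hD0 hL hg _)]
  simp_rw [hdiff]
  -- Tannery's theorem
  have hbound_sum : Summable fun k : ℕ ↦ 2 * (q * rexp (D * (π / p))) * r ^ k :=
    (summable_geometric_of_lt_one hr0 hr1).mul_left _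
  refine tendsto_tsum_of_dominated_convergence hbound_sum (fun k ↦ ?_) ?_
  · have h := (tendsto_g_right hL hg (fun j ↦ (hx j).1) hx0 k).sub
      (tendsto_g_left hL hg (fun j ↦ (hy j).2) hy0 k)
    simpa only [sub_mul] using h
  · refine Eventually.of_forall fun j k ↦ ?_
    have h1 : ‖g (x j + k * L)‖ ≤ q * rexp (D * (π / p)) * r ^ k := by
      refine (norm_g_translate_le hχ hg (x j) k).trans ?_
      rw [hr]
      gcongr
      nlinarith [(hx j).1, (hx j).2]
    have h2 : ‖g (y j + k * L)‖ ≤ q * rexp (D * (π / p)) * r ^ k := by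
      refine (norm_g_translate_le hχ hg (y j) k).trans ?_
      rw [hr]
      gcongr
      nlinarith [(hy j).1, (hy j).2]
    calc ‖g (x j + k * L) - g (y j + k * L)‖ ≤ ‖g (x j + k * L)‖ + ‖g (y j + k * L)‖ :=
          norm_sub_le _ _
      _ ≤ _ := by linarith

/-! ### The jump is non-zero: integral powers of `λ = e^L` -/

/-- If some power `λ^k`, `k ≥ 1`, of a real `λ > 0` is a natural number, then the exponents
`k` with `λ^k ∈ ℕ` are exactly the multiples of the least such exponent `k₀`: writing
`k = ek₀ + r`, `λ^r = λ^k/λ^{ek₀}` is rational with `(λ^r)^{k₀} ∈ ℕ`, hence an integer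
(`irrational_nrt_of_notint_nrt`), so `r = 0`. [folklore] -/
private theorem dvd_of_isNatPow {lam : ℝ} (hlam : 0 < lam) {k₀ : ℕ} (hk₀ : 0 < k₀) {m₀ : ℕ}
    (hm₀ : (m₀ : ℝ) = lam ^ k₀)
    (hmin : ∀ k, 0 < k → k < k₀ → ∀ m : ℕ, (m : ℝ) ≠ lam ^ k)
    {k : ℕ} {m : ℕ} (hm : (m : ℝ) = lam ^ k) : k₀ ∣ k := by
  set e := k / k₀ with he
  set r := k % k₀ with hrdef
  have hk : k₀ * e + r = k := Nat.div_add_mod k k₀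
  have hm₀pos : (0 : ℝ) < m₀ := by rw [hm₀]; positivity
  -- `λ^r = m / m₀^e`
  have hlr : lam ^ r = (m : ℝ) / (m₀ : ℝ) ^ e := by
    rw [eq_div_iff (by positivity), hm, hm₀, ← pow_mul, ← pow_add, add_comm, hk]
  -- `(λ^r)^{k₀} = m₀^r`
  have hpow : (lam ^ r) ^ k₀ = ((m₀ ^ r : ℕ) : ℤ) := by
    push_cast
    rw [hm₀, ← pow_mul, ← pow_mul, mul_comm]
  -- `λ^r` is rational, hence an integer
  have hrat : ¬ Irrational (lam ^ r) := by
    rw [hlr, show (m : ℝ) / (m₀ : ℝ) ^ e = (((m : ℚ) / (m₀ : ℚ) ^ e : ℚ) : ℝ) by push_cast; rfl]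
    exact Rat.not_irrational _
  have hint : ∃ z : ℤ, lam ^ r = z := by
    by_contra hne
    exact hrat (irrational_nrt_of_notint_nrt k₀ _ hpow hne hk₀)
  obtain ⟨z, hz⟩ := hint
  have hzpos : (0 : ℤ) < z := by
    have : (0 : ℝ) < (z : ℝ) := by rw [← hz]; positivity
    exact_mod_cast this
  -- so `λ^r ∈ ℕ`, and minimality forces `r = 0`
  have hnat : ((z.toNat : ℕ) : ℝ) = lam ^ r := by
    rw [hz]
    have : ((z.toNat : ℤ) : ℝ) = (z : ℝ) := by rw [Int.toNat_of_nonneg hzpos.le]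
    exact_mod_cast this
  have hr0 : r = 0 := by
    by_contra hr
    exact hmin r (Nat.pos_of_ne_zero hr) (Nat.mod_lt k hk₀) z.toNat hnat.symm.symm
  exact Nat.dvd_of_mod_eq_zero hr0

omit [NeZero q] in
/-- The jump coefficient `S(⌊u⌋) − S(⌈u⌉ − 1)` is `χ(m)` at a natural number `u = m ≥ 1`.
[folklore] -/
private theorem jumpCoeff_of_eq_natCast {u : ℝ} {m : ℕ} (hm1 : 1 ≤ m) (hu : (m : ℝ) = u) :
    partialSum χ ⌊u⌋₊ - partialSum χ (⌈u⌉₊ - 1) = χ ((m : ℕ) : ZMod q) := by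
  rw [← hu, Nat.floor_natCast, Nat.ceil_natCast]
  obtain ⟨m', rfl⟩ := Nat.exists_eq_add_of_le' hm1
  rw [Nat.add_sub_cancel, DirichletAbel.partialSum_succ, add_sub_cancel_left]

omit [NeZero q] in
/-- The jump coefficient vanishes at a non-integer `u ≥ 0`. [folklore] -/
private theorem jumpCoeff_of_ne_natCast {u : ℝ} (hu0 : 0 ≤ u) (hu : ∀ m : ℕ, (m : ℝ) ≠ u) :
    partialSum χ ⌊u⌋₊ - partialSum χ (⌈u⌉₊ - 1) = 0 := by
  have hfl : (⌊u⌋₊ : ℝ) < u := lt_of_le_of_ne (Nat.floor_le hu0) (hu _)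
  have hceil : ⌈u⌉₊ = ⌊u⌋₊ + 1 := by
    rw [Nat.ceil_eq_iff (by positivity : ⌊u⌋₊ + 1 ≠ 0), Nat.add_sub_cancel]
    exact ⟨hfl, by push_cast; exact (Nat.lt_floor_add_one u).le⟩
  rw [hceil, Nat.add_sub_cancel, sub_self]

omit [NeZero q] in
/-- **The jump of `Φ` at `0` is non-zero.** With `λ = e^L`, `L > 0`, `D > 0`:
`Σ_k (S(⌊λ^k⌋) − S(⌈λ^k⌉ − 1)) λ^{−kD} ≠ 0` — the sum is `1` if no `λ^k` (`k ≥ 1`) is an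
integer, and otherwise the geometric series `Σ_j (χ(m₀) m₀^{−D})^j = (1 − χ(m₀)m₀^{−D})^{−1}`,
`m₀ = λ^{k₀} ≥ 2` the least integral power. [folklore] -/
private theorem tsum_jump_ne_zero {D L : ℝ} (hD0 : 0 < D) (hL : 0 < L) :
    ∑' k : ℕ, (partialSum χ ⌊rexp (k * L)⌋₊ - partialSum χ (⌈rexp (k * L)⌉₊ - 1)) *
        (rexp (-(D * (k * L))) : ℂ) ≠ 0 := by
  set lam : ℝ := rexp L with hlam
  have hlam0 : 0 < lam := Real.exp_pos L
  have hlam1 : 1 < lam := Real.one_lt_exp_iff.mpr hL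
  have hpowk : ∀ k : ℕ, rexp (k * L) = lam ^ k := fun k ↦ by rw [hlam, ← Real.exp_nat_mul]
  set J : ℕ → ℂ := fun k ↦ (partialSum χ ⌊rexp (k * L)⌋₊ - partialSum χ (⌈rexp (k * L)⌉₊ - 1)) *
    (rexp (-(D * (k * L))) : ℂ) with hJ
  change ∑' k : ℕ, J k ≠ 0
  -- the term `k = 0` is `1`
  have hJ0 : J 0 = 1 := by
    rw [hJ]; dsimp only
    rw [Nat.cast_zero, zero_mul, Real.exp_zero, mul_zero, neg_zero, Real.exp_zero,
      jumpCoeff_of_eq_natCast (m := 1) le_rfl (by simp)]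
    simp
  by_cases hex : ∃ k : ℕ, 0 < k ∧ ∃ m : ℕ, (m : ℝ) = lam ^ k
  · -- integral powers exist: `k₀` the least exponent, `m₀ = λ^{k₀}`
    classical
    let k₀ := Nat.find hex
    have hk₀spec := Nat.find_spec hex
    have hk₀ : 0 < k₀ := hk₀spec.1
    obtain ⟨m₀, hm₀⟩ := hk₀spec.2
    have hmin : ∀ k, 0 < k → k < k₀ → ∀ m : ℕ, (m : ℝ) ≠ lam ^ k := by
      intro k hk hlt m hm
      exact Nat.find_min hex hlt ⟨hk, m, hm⟩
    have hm₀ge : (1 : ℝ) < m₀ := by rw [hm₀]; exact one_lt_pow₀ hlam1 hk₀.ne'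
    have hm₀1 : 1 ≤ m₀ := by exact_mod_cast hm₀ge.le
    -- the ratio `w = χ(m₀) e^{-D k₀ L}`, `‖w‖ < 1`
    set w : ℂ := χ ((m₀ : ℕ) : ZMod q) * (rexp (-(D * (k₀ * L))) : ℂ) with hw
    have hwnorm : ‖w‖ < 1 := by
      rw [hw, norm_mul, Complex.norm_real, Real.norm_eq_abs, abs_of_pos (Real.exp_pos _)]
      have h1 : ‖χ ((m₀ : ℕ) : ZMod q)‖ ≤ 1 := χ.norm_le_one _
      have h2 : rexp (-(D * (k₀ * L))) < 1 :=
        Real.exp_lt_one_iff.mpr (neg_lt_zero.mpr (by positivity))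
      calc ‖χ ((m₀ : ℕ) : ZMod q)‖ * rexp (-(D * (k₀ * L))) ≤ 1 * rexp (-(D * (k₀ * L))) :=
            mul_le_mul_of_nonneg_right h1 (Real.exp_pos _).le
        _ < 1 := by rw [one_mul]; exact h2
    -- along the multiples of `k₀` the terms are `w^j`
    have hJmul : ∀ j : ℕ, J (k₀ * j) = w ^ j := by
      intro j
      rw [hJ]; dsimp only
      have hmj : (((m₀ ^ j : ℕ)) : ℝ) = rexp (((k₀ * j : ℕ) : ℝ) * L) := by
        rw [hpowk, pow_mul, ← hm₀]; push_cast; ring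
      rw [jumpCoeff_of_eq_natCast (Nat.one_le_pow _ _ hm₀1) hmj, hw, mul_pow, ← Complex.ofReal_pow,
        ← Real.exp_nat_mul, Nat.cast_pow, map_pow]
      congr 2
      push_cast
      congr 1
      ring
    -- off the multiples of `k₀` the terms vanish
    have hsupp : Function.support J ⊆ Set.range (fun j : ℕ ↦ k₀ * j) := by
      intro k hk
      rw [Function.mem_support] at hk
      by_cases hint : ∃ m : ℕ, (m : ℝ) = lam ^ k
      · obtain ⟨m, hm⟩ := hint
        obtain ⟨j, hj⟩ := dvd_of_isNatPow hlam0 hk₀ hm₀ hmin hm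
        exact ⟨j, hj.symm⟩
      · exfalso
        apply hk
        rw [hJ]; dsimp only
        push Not at hint
        rw [jumpCoeff_of_ne_natCast (Real.exp_pos _).le (fun m ↦ by rw [hpowk]; exact hint m),
          zero_mul]
    have hinj : Function.Injective (fun j : ℕ ↦ k₀ * j) := fun a b hab ↦
      Nat.eq_of_mul_eq_mul_left hk₀ hab
    rw [← hinj.tsum_eq hsupp]
    simp_rw [hJmul]
    rw [tsum_geometric_of_norm_lt_one hwnorm]
    refine inv_ne_zero (sub_ne_zero.mpr fun h1 ↦ ?_)
    rw [← h1, norm_one] at hwnorm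
    exact lt_irrefl _ hwnorm
  · -- no integral power: only the term `k = 0` survives
    push Not at hex
    have hJk : ∀ k : ℕ, k ≠ 0 → J k = 0 := by
      intro k hk
      rw [hJ]; dsimp only
      rw [jumpCoeff_of_ne_natCast (Real.exp_pos _).le (fun m ↦ by
        rw [hpowk]; exact hex k (Nat.pos_of_ne_zero hk) m), zero_mul]
    rw [tsum_eq_single 0 fun k hk ↦ hJk k hk, hJ0]
    exact one_ne_zero

/-- **No a.e.-constant.** The translates-sum `Φ` of `g(y) = 𝟙_{y>0}S(⌊e^y⌋)e^{-Dy}` cannot agree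
a.e. with a constant on the period interval: along a.e.-good points `x_j ↓ 0`, `y_j ↑ 0` the
difference `Φ(x_j) − Φ(y_j)` tends to the non-zero jump of `Φ` at `0`.
[cite: Putnam1954, pp. 97–99; LapidusVanfrankenhuijsen2006, Theorem 11.17] -/
theorem not_ae_eq_const (hχ : χ ≠ 1) {D p : ℝ} (hD0 : 0 < D) (hp : 0 < p) {g Φ : ℝ → ℂ}
    (hg : ∀ y, g y = if 0 < y then partialSum χ ⌊rexp y⌋₊ * (rexp (-(D * y)) : ℂ) else 0)
    (hΦ : ∀ x, Φ x = ∑' k : ℕ, g (x + k * (2 * π / p)))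
    (c : ℂ) (hae : ∀ᵐ x ∂(volume.restrict (Ioc (-(π / p)) (π / p))), Φ x = c) : False := by
  have hb0 : 0 < π / p := div_pos Real.pi_pos hp
  have hL0 : 0 < 2 * π / p := by positivity
  -- good points on both sides of `0`, at distance `< (π/p)/(j+1)`
  have hne : ∀ {a b : ℝ}, a < b → (ae (volume.restrict (Ioo a b))).NeBot := by
    intro a b hab
    rw [ae_neBot, Ne, Measure.restrict_eq_zero, Real.volume_Ioo, ENNReal.ofReal_eq_zero, not_le]
    linarith
  set δ : ℕ → ℝ := fun j ↦ (π / p) / ((j : ℝ) + 1) with hδ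
  have hδpos : ∀ j, 0 < δ j := fun j ↦ by positivity
  have hδle : ∀ j, δ j ≤ π / p := fun j ↦ by
    rw [hδ]; dsimp only
    exact div_le_self hb0.le (by linarith [(Nat.cast_nonneg j : (0 : ℝ) ≤ j)])
  have hδ0 : Tendsto δ atTop (𝓝 0) := by
    have := tendsto_one_div_add_atTop_nhds_zero_nat.const_mul (π / p)
    rw [mul_zero] at this
    refine this.congr fun j ↦ ?_
    rw [hδ]; dsimp only; ring
  have hexx : ∀ j : ℕ, ∃ x, x ∈ Ioo 0 (δ j) ∧ Φ x = c := by
    intro j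
    have hsub : Ioo 0 (δ j) ⊆ Ioc (-(π / p)) (π / p) :=
      fun x hx ↦ ⟨by linarith [hx.1], by linarith [hx.2, hδle j]⟩
    haveI := hne (hδpos j)
    exact ((ae_restrict_mem measurableSet_Ioo).and
      (ae_restrict_of_ae_restrict_of_subset hsub hae)).exists
  have hexy : ∀ j : ℕ, ∃ y, y ∈ Ioo (-(δ j)) 0 ∧ Φ y = c := by
    intro j
    have hsub : Ioo (-(δ j)) 0 ⊆ Ioc (-(π / p)) (π / p) :=
      fun y hy ↦ ⟨by linarith [hy.1, hδle j], by linarith [hy.2]⟩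
    haveI := hne (by linarith [hδpos j] : -(δ j) < 0)
    exact ((ae_restrict_mem measurableSet_Ioo).and
      (ae_restrict_of_ae_restrict_of_subset hsub hae)).exists
  choose x hx hxc using hexx
  choose y hy hyc using hexy
  have hx' : ∀ j, x j ∈ Ioo 0 (π / p) := fun j ↦ ⟨(hx j).1, lt_of_lt_of_le (hx j).2 (hδle j)⟩
  have hy' : ∀ j, y j ∈ Ioo (-(π / p)) 0 :=
    fun j ↦ ⟨lt_of_le_of_lt (neg_le_neg (hδle j)) (hy j).1, (hy j).2⟩
  have hx0 : Tendsto x atTop (𝓝 0) :=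
    squeeze_zero (fun j ↦ (hx j).1.le) (fun j ↦ (hx j).2.le) hδ0
  have hy0 : Tendsto y atTop (𝓝 0) := by
    have hneg : Tendsto (fun j ↦ -δ j) atTop (𝓝 0) := by simpa using hδ0.neg
    exact tendsto_of_tendsto_of_tendsto_of_le_of_le hneg tendsto_const_nhds
      (fun j ↦ (hy j).1.le) (fun j ↦ (hy j).2.le)
  -- the difference is identically zero but tends to the non-zero jump
  have hlim := tendsto_phi_sub_phi hχ hD0 hp hg hΦ hx' hy' hx0 hy0
  have hzero : (fun j ↦ Φ (x j) - Φ (y j)) = fun _ ↦ (0 : ℂ) := by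
    funext j; rw [hxc, hyc, sub_self]
  rw [hzero] at hlim
  have h := tendsto_nhds_unique (tendsto_const_nhds (x := (0 : ℂ)) (f := (atTop : Filter ℕ))) hlim
  exact tsum_jump_ne_zero (χ := χ) hD0 hL0 h.symm

end PutnamDirichlet

/-- **Lapidus–van Frankenhuijsen 2006, Theorem 11.17 for Dirichlet `L`-series: no Dirichlet
`L`-function has an infinite vertical arithmetic progression of zeros** — for `χ` mod `N`,
`0 < D < 1` and `p > 0` some `L(D + inp, χ)`, `n ≠ 0`, is non-zero. Proof: for the principal
character `L(s, 1_N) = ζ(s)∏_{p∣N}(1 − p^{−s})` with non-vanishing Euler factors on `Re s > 0`,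
so this is Putnam's theorem for `ζ` (`LapidusVanFrankenhuijsen2006_thm11_1_holds`); for `χ ≠ χ₀`
Putnam's Fourier-series argument is run on `L(s, χ)/s = ∫_0^∞ S(⌊e^y⌋)e^{−sy} dy`
(`PutnamDirichlet.ae_eq_const`, `PutnamDirichlet.not_ae_eq_const`).
[cite: LapidusVanfrankenhuijsen2006, Theorem 11.17; Putnam1954, pp. 97–99] -/
theorem LapidusVanFrankenhuijsen2006_thm11_17_dirichlet_holds :
    LapidusVanFrankenhuijsen2006_thm11_17_dirichlet := by
  intro N _ χ D p hD0 hD1 hp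
  by_cases hχ : χ = 1
  · -- principal character: reduce to `ζ`
    subst hχ
    obtain ⟨n, hn, hζ⟩ := LapidusVanFrankenhuijsen2006_thm11_1_holds D p hD0 hD1 hp
    refine ⟨n, hn, ?_⟩
    set s : ℂ := (D : ℂ) + (n : ℂ) * (p : ℂ) * I with hs
    have hsre : s.re = D := by simp [hs]
    have hs1 : s ≠ 1 := fun h ↦ by
      have := congrArg Complex.re h; rw [hsre] at this; simp at this; linarith
    change DirichletCharacter.LFunctionTrivChar N s ≠ 0
    rw [DirichletCharacter.LFunctionTrivChar_eq_mul_riemannZeta hs1]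
    refine mul_ne_zero (Finset.prod_ne_zero_iff.mpr fun l hl ↦ ?_) hζ
    have hl2 : 2 ≤ l := (Nat.prime_of_mem_primeFactors hl).two_le
    intro h0
    have h1 : (l : ℂ) ^ (-s) = 1 := by
      have := sub_eq_zero.mp h0
      exact this.symm
    have hnorm : ‖(l : ℂ) ^ (-s)‖ = (l : ℝ) ^ (-D) := by
      rw [Complex.norm_natCast_cpow_of_pos (by omega)]
      simp [hsre]
    have hlt : (l : ℝ) ^ (-D) < 1 :=
      Real.rpow_lt_one_of_one_lt_of_neg (by exact_mod_cast hl2) (by linarith)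
    rw [← hnorm, h1, norm_one] at hlt
    exact lt_irrefl _ hlt
  · -- non-principal character: Putnam's argument
    by_contra hcon
    have hzero : ∀ n : ℤ, n ≠ 0 → χ.LFunction (D + I * n * p) = 0 := fun n hn ↦ by
      by_contra h
      exact hcon ⟨n, hn, by rwa [show (D : ℂ) + n * p * I = D + I * n * p by ring]⟩
    obtain ⟨c, hc⟩ := PutnamDirichlet.ae_eq_const hχ hD0 hp
      (g := fun y ↦ if 0 < y then partialSum χ ⌊rexp y⌋₊ * (rexp (-(D * y)) : ℂ) else 0)
      (Φ := fun x ↦ ∑' k : ℕ,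
        (fun y ↦ if 0 < y then partialSum χ ⌊rexp y⌋₊ * (rexp (-(D * y)) : ℂ) else 0)
          (x + k * (2 * π / p)))
      (fun _ ↦ rfl) (fun _ ↦ rfl) hzero
    exact PutnamDirichlet.not_ae_eq_const hχ hD0 hp (fun _ ↦ rfl) (fun _ ↦ rfl) c hc

end Literature.NumberTheory.LFunctions

end
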